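import Summits.CriticalPhenomena.CardyFormulaZ2.Theorems.CardySusyWardWeakHolomorphyComposition
import Summits.CriticalPhenomena.CardyFormulaZ2.Theorems.CardySusyWardWeakHolomorphyKirchhoffIdentity
import Summits.CriticalPhenomena.CardyFormulaZ2.Theorems.CardySusyWardWeakHolomorphyRegroup
import Summits.CriticalPhenomena.CardyFormulaZ2.Theorems.CardySusyWardWeakHolomorphyCount
import Summits.CriticalPhenomena.CardyFormulaZ2.Theorems.CardySusyWardWeakHolomorphyCalculus
import Summits.CriticalPhenomena.CardyFormulaZ2.Theorems.CardySusyWardWeakHolomorphyTaylorComb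
import Summits.CriticalPhenomena.CardyFormulaZ2.Theorems.CardySusyWardWeakHolomorphyBulkDichotomy
import Summits.CriticalPhenomena.CardyFormulaZ2.Theorems.CardySusyWardWeakHolomorphyHalfCR
import Summits.CriticalPhenomena.CardyFormulaZ2.Theses.CardySusyWard
import Summits.CriticalPhenomena.CardyFormulaZ2.Theorems.CardyComplexConeEdgePrecompactShiftStabilityReduction
import Literature.Probability.LatticeModels.InnerFacesHoleFree

/-!
# The reduction of the crux `CardySusyWard.WeakHolomorphy` (stmt-CriticalPhenomena-11292) to the
# `L¹` once-visit chirality law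

Line `Sketch`, lead prover `prover-line-stmt-CriticalPhenomena-11292-c2-0` (after leads `-0`, `-1`, `c1`).
Sorry-free and CONDITIONAL: the one open statement of the line — the `L¹` once-visit chirality law
(`Σ_{p over K} ‖κ_L Z_L(p) + κ_R Z_R(p)‖ ≤ ε δ^{-5/3}` eventually, `Z_t = onceChiralObs`,
`κ_t = onceKappa`; registered stub `stub_onceChiralityLawL1`, crux-sized: it is the weak dual half of
discrete Cauchy–Riemann at `q = 1`, DCS 2012 Conj. 8.7) — enters as a HYPOTHESIS, and everything
downstream of it is proved from the landed files of the line: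
the law + `stub_kirchhoffIdentity` (p114738) + `stub_bulkDichotomy` (p90488) ⟹ the `L¹`
Kirchhoff law of the dart observable (registered stub `stub_kirchhoffL1OfChiralityLaw`) ⟹ the bypass's
transfer statement `C⁺` with `G = 0` (registered stub `stub_splittingOfKirchhoffL1`); `stub_halfCR` (p91384) +
`stub_bulkDichotomy` ⟹ the `L¹` vertex-relation defect bound (registered stub `stub_vertexRelationL1`);
then the landed bypass `stub_composition` (p91118) with `stub_regroup` / `stub_count` / `stub_calculus` /
`stub_taylorComb` (p87118 p87161 p87523 p88001) ⟹ the crux (`weakHolomorphy_of_onceChiralityLawL1`).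
References: Duminil-Copin–Smirnov, *Conformal invariance of lattice models*, arXiv:1109.1549, §8.3,
Prop. 8.6, Conj. 8.7; Duminil-Copin, arXiv:1208.3787, Prop. 4; Zhou, arXiv:2409.03235, §4 eq. (102);
crux workfiles `Cruxes/WeakHolomorphy/Lines/Sketch.{lean,md}`, `STRATEGY-CENSUS.md`, `CensusSketch.lean`.
-/

noncomputable section

namespace Summit.CriticalPhenomena.CardyFormulaZ2.Theorems.WeakHolomorphy.SplitBypass

open scoped BigOperators Topology
open Filter Set MeasureTheory Complex
open _root_.Literature.Probability.LatticeModels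
open _root_.Literature.Probability.RandomPlanarGeometry (DobrushinDomain)
open _root_.Literature.Probability.Percolation (BondConfig bondPercolation half)
open _root_.Literature.Barriers.CriticalPhenomena (medialCornersAt medialVertexOf halfCRForm HalfCRRelationAt
  halfCRForm_apply halfCRRelationAt_iff)
open _root_.Literature.Barriers.CriticalPhenomena.HalfCRGreen (coeff twin)
open Summit.CriticalPhenomena.CardyFormulaZ2.Theorems.ParafermionPrecompact.Negative (F IsFamily)
open Summit.CriticalPhenomena.CardyFormulaZ2.Theorems.ParafermionFamiliesToSLESix.StripAnchored (IsInteriorMV)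
open Summit.CriticalPhenomena.CardyFormulaZ2.Cruxes.EdgePrecompact.QkzStripBoundaryArm (cornerObs cornerObs_eq_bondDartObservable)

/-! ## Glue -/

/-- In the second branch of the bulk dichotomy every corner value of the dart observable above `K`
vanishes. [folklore] -/
theorem bondDartObservable_eq_zero_of_vanish {Λ : ℝ → DiscreteDobrushin} {δ : ℝ} {p : Site 2 × Fin 2}
    (hvan : ∀ (k : Fin 4) (ω : BondConfig (Site 2)),
      Parafermion.dartPhaseSum (medialExploration (Λ δ) ω) δ (1 / 3) (medialCornersAt p.1 p.2 k) = 0)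
    (k : Fin 4) : bondDartObservable (Λ δ) δ (1 / 3) (medialCornersAt p.1 p.2 k) = 0 := by
  rw [Parafermion.bondDartObservable_def]
  simp only [hvan k, MeasureTheory.integral_zero]

/-- **The `L¹` Kirchhoff law of the dart observable from the chirality law.**
Along every admissible family, over every compact `K ⊂ Ω`, for every `ε > 0`, eventually in `δ`:
`Σ_{p over K} ‖F(NE) + F(SW) − F(NW) − F(SE)‖ ≤ ε δ^{-5/3}` (`F = bondDartObservable (Λ δ) δ (1/3)`,
corners `NW, NE, SE, SW = 0, 1, 2, 3`).  Proof: bulk dichotomy; at interior vertices the exact identity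
`stub_kirchhoffIdentity` (inner faces of a Jordan carrier are hole-free, `holeFree_innerFaces`) turns
each summand into `‖κ_L Z_L + κ_R Z_R‖`; in the other branch every summand is `0`. [folklore] -/
theorem stub_kirchhoffL1OfChiralityLaw :
    (∀ (D : DobrushinDomain) (Λ : ℝ → DiscreteDobrushin), IsFamily D Λ →
      ∀ (K : Set ℂ), IsCompact K → K ⊆ D.carrier → ∀ ε > (0:ℝ), ∀ᶠ δ in 𝓝[>] (0:ℝ),
        ∀ S : Finset (Site 2 × Fin 2), (∀ p ∈ S, medialPoint δ (medialVertexOf p) ∈ K) →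
          ∑ p ∈ S, ‖onceKappa true * onceChiralObs (Λ δ) δ (1 / 3) (medialVertexOf p) true +
              onceKappa false * onceChiralObs (Λ δ) δ (1 / 3) (medialVertexOf p) false‖ ≤
            ε * δ ^ (-(5:ℝ) / 3)) →
    ∀ (D : DobrushinDomain) (Λ : ℝ → DiscreteDobrushin), IsFamily D Λ →
      ∀ (K : Set ℂ), IsCompact K → K ⊆ D.carrier → ∀ ε > (0:ℝ), ∀ᶠ δ in 𝓝[>] (0:ℝ),
        ∀ S : Finset (Site 2 × Fin 2), (∀ p ∈ S, medialPoint δ (medialVertexOf p) ∈ K) →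
          ∑ p ∈ S, ‖bondDartObservable (Λ δ) δ (1 / 3) (medialCornersAt p.1 p.2 1) +
              bondDartObservable (Λ δ) δ (1 / 3) (medialCornersAt p.1 p.2 3) -
              bondDartObservable (Λ δ) δ (1 / 3) (medialCornersAt p.1 p.2 0) -
              bondDartObservable (Λ δ) δ (1 / 3) (medialCornersAt p.1 p.2 2)‖ ≤ ε * δ ^ (-(5:ℝ) / 3)  := by
  intro hlaw D Λ hΛ K hK hKD ε hε
  have hadm := hΛ.2.2.2.2.2
  filter_upwards [hlaw D Λ hΛ K hK hKD ε hε, stub_bulkDichotomy D Λ hΛ K hK hKD, hadm, self_mem_nhdsWithin]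
    with δ hlawδ hdich hA hδpos S hS
  have hδ0 : (0:ℝ) < δ := hδpos
  refine le_trans (Finset.sum_le_sum fun p hp => ?_) (hlawδ S hS)
  rcases hdich with hint | hvan
  · have hHF : HoleFree {f : Site 2 | (Λ δ).IsInnerFace f} :=
      holeFree_innerFaces D.toJordanDomain (hΛ.1 δ) (by rw [hΛ.2.1 δ]; exact hδ0)
    have h := stub_kirchhoffIdentity (Λ δ) hA hHF p (hint p (hS p hp)) δ hδ0
    rw [h, norm_mul]
    have hs : ‖(if p.2 = 0 then (1 : ℂ) else -1)‖ = 1 := by split_ifs <;> simp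
    rw [hs, one_mul]
  · simp only [bondDartObservable_eq_zero_of_vanish (hvan p (hS p hp)), add_zero, sub_self, norm_zero]
    exact norm_nonneg _

/-- **The bypass's transfer statement `C⁺` (registered signature of `stub_staggeredSplittingL1`) with
`G = 0`**, from the `L¹` Kirchhoff law: with `G = 0` the vertex-relation defect of `G` and the anti-Kirchhoff defect `Σ_k G` vanish
and the staggered Kirchhoff defect of `F − G` is that of `F`. [folklore] -/
theorem stub_splittingOfKirchhoffL1 :
    (∀ (D : DobrushinDomain) (Λ : ℝ → DiscreteDobrushin), IsFamily D Λ →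
      ∀ (K : Set ℂ), IsCompact K → K ⊆ D.carrier → ∀ ε > (0:ℝ), ∀ᶠ δ in 𝓝[>] (0:ℝ),
        ∀ S : Finset (Site 2 × Fin 2), (∀ p ∈ S, medialPoint δ (medialVertexOf p) ∈ K) →
          ∑ p ∈ S, ‖bondDartObservable (Λ δ) δ (1 / 3) (medialCornersAt p.1 p.2 1) +
              bondDartObservable (Λ δ) δ (1 / 3) (medialCornersAt p.1 p.2 3) -
              bondDartObservable (Λ δ) δ (1 / 3) (medialCornersAt p.1 p.2 0) -
              bondDartObservable (Λ δ) δ (1 / 3) (medialCornersAt p.1 p.2 2)‖ ≤ ε * δ ^ (-(5:ℝ) / 3)) →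
    ∀ (D : DobrushinDomain) (Λ : ℝ → DiscreteDobrushin), IsFamily D Λ →
    ∀ (K : Set ℂ), IsCompact K → K ⊆ D.carrier → ∀ ε > (0:ℝ), ∀ᶠ δ in 𝓝[>] (0:ℝ),
      ∃ G : Site 2 × Site 2 → ℂ, (∀ c, ‖G c‖ ≤ δ⁻¹) ∧
        ∀ S : Finset (Site 2 × Fin 2), (∀ p ∈ S, medialPoint δ (medialVertexOf p) ∈ K) →
          ∑ p ∈ S, (‖halfCRForm Complex.I p G‖ / δ +
            ‖(bondDartObservable (Λ δ) δ (1 / 3) (medialCornersAt p.1 p.2 1) - G (medialCornersAt p.1 p.2 1)) +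
              (bondDartObservable (Λ δ) δ (1 / 3) (medialCornersAt p.1 p.2 3) - G (medialCornersAt p.1 p.2 3)) -
              (bondDartObservable (Λ δ) δ (1 / 3) (medialCornersAt p.1 p.2 0) - G (medialCornersAt p.1 p.2 0)) -
              (bondDartObservable (Λ δ) δ (1 / 3) (medialCornersAt p.1 p.2 2) - G (medialCornersAt p.1 p.2 2))‖ +
            ‖∑ k : Fin 4, G (medialCornersAt p.1 p.2 k)‖) ≤ ε * δ ^ (-(5:ℝ) / 3)  := by
  intro hK1 D Λ hΛ K hK hKD ε hε
  filter_upwards [hK1 D Λ hΛ K hK hKD ε hε, self_mem_nhdsWithin] with δ hKδ hδpos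
  have hδ0 : (0:ℝ) < δ := hδpos
  refine ⟨0, fun c => by simp [hδ0.le], fun S hS => ?_⟩
  simpa only [map_zero, norm_zero, zero_div, zero_add, Pi.zero_apply, sub_zero, Finset.sum_const_zero,
    add_zero] using hKδ S hS

/-- **The `L¹` vertex-relation defect bound** (registered signature of `stub_vertexRelationL1`), from the landed exact vertex
relation `stub_halfCR` (chirality `+i`, hole-free admissible data, Duminil-Copin 2012 Prop. 4) and the
bulk dichotomy: either the relation is exact or all four corner values vanish; either way the defect is
`0 ≤ ε δ^{-2/3}`. [cite: DuminilCopin2012Parafermion, Proposition 4] -/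
theorem stub_vertexRelationL1 : ∀ (D : DobrushinDomain) (Λ : ℝ → DiscreteDobrushin), IsFamily D Λ →
    ∀ (K : Set ℂ), IsCompact K → K ⊆ D.carrier → ∀ ε > (0:ℝ), ∀ᶠ δ in 𝓝[>] (0:ℝ),
      ∀ S : Finset (Site 2 × Fin 2), (∀ p ∈ S, medialPoint δ (medialVertexOf p) ∈ K) →
        ∑ p ∈ S, ‖halfCRForm Complex.I p (fun c => bondDartObservable (Λ δ) δ (1 / 3) c)‖
          ≤ ε * δ ^ (-(2:ℝ) / 3)  := by
  intro D Λ hΛ K hK hKD ε hε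
  have hadm := hΛ.2.2.2.2.2
  filter_upwards [stub_bulkDichotomy D Λ hΛ K hK hKD, hadm, self_mem_nhdsWithin] with δ hdich hA hδpos S hS
  have hδ0 : (0:ℝ) < δ := hδpos
  have hzero : ∀ p ∈ S, ‖halfCRForm Complex.I p (fun c => bondDartObservable (Λ δ) δ (1 / 3) c)‖ = 0 := by
    intro p hp
    rcases hdich with hint | hvan
    · have hHF : HoleFree {f : Site 2 | (Λ δ).IsInnerFace f} :=
        holeFree_innerFaces D.toJordanDomain (hΛ.1 δ) (by rw [hΛ.2.1 δ]; exact hδ0)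
      have h := stub_halfCR (Λ δ) hA hHF p (hint p (hS p hp)) δ hδ0
      rw [halfCRRelationAt_iff] at h
      have hfun : (fun c : Site 2 × Site 2 => bondDartObservable (Λ δ) δ (1 / 3) c) =
          fun c : Site 2 × Site 2 => cornerObs (Λ δ) δ c.1 c.2 := by
        funext c; rw [cornerObs_eq_bondDartObservable]
      rw [hfun, h, norm_zero]
    · rw [halfCRForm_apply]
      simp only [bondDartObservable_eq_zero_of_vanish (hvan p (hS p hp)), sub_self, mul_zero, norm_zero]
  rw [Finset.sum_eq_zero hzero]
  positivity

/-- **The reduction: the `L¹` once-visit chirality law implies the crux `WeakHolomorphy`** (so does the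
`L¹` Kirchhoff law, `weakHolomorphy_of_kirchhoffL1`).  CONDITIONAL on the open law; credits nothing by
itself. [cite: DuminilCopinSmirnov2012Lattice, Conjecture 8.7] -/
theorem weakHolomorphy_of_kirchhoffL1
    (hK1 : ∀ (D : DobrushinDomain) (Λ : ℝ → DiscreteDobrushin), IsFamily D Λ →
      ∀ (K : Set ℂ), IsCompact K → K ⊆ D.carrier → ∀ ε > (0:ℝ), ∀ᶠ δ in 𝓝[>] (0:ℝ),
        ∀ S : Finset (Site 2 × Fin 2), (∀ p ∈ S, medialPoint δ (medialVertexOf p) ∈ K) →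
          ∑ p ∈ S, ‖bondDartObservable (Λ δ) δ (1 / 3) (medialCornersAt p.1 p.2 1) +
              bondDartObservable (Λ δ) δ (1 / 3) (medialCornersAt p.1 p.2 3) -
              bondDartObservable (Λ δ) δ (1 / 3) (medialCornersAt p.1 p.2 0) -
              bondDartObservable (Λ δ) δ (1 / 3) (medialCornersAt p.1 p.2 2)‖ ≤ ε * δ ^ (-(5:ℝ) / 3)) :
    Summit.CriticalPhenomena.CardyFormulaZ2.Theses.CardySusyWard.WeakHolomorphy := by
  intro D Λ h1 h2 h3 h4 h5 h6 φ hφ hc hs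
  exact stub_composition stub_regroup stub_calculus stub_taylorComb stub_count stub_vertexRelationL1
    (stub_splittingOfKirchhoffL1 hK1) D Λ ⟨h1, h2, h3, h4, h5, h6⟩ φ hφ hc hs

/-- **The reduction: the `L¹` once-visit chirality law implies the crux `WeakHolomorphy`.**
CONDITIONAL on the open law (registered stub `stub_onceChiralityLawL1`); credits nothing by itself.
[cite: DuminilCopinSmirnov2012Lattice, Conjecture 8.7] -/
theorem weakHolomorphy_of_onceChiralityLawL1
    (hlaw : ∀ (D : DobrushinDomain) (Λ : ℝ → DiscreteDobrushin), IsFamily D Λ →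
      ∀ (K : Set ℂ), IsCompact K → K ⊆ D.carrier → ∀ ε > (0:ℝ), ∀ᶠ δ in 𝓝[>] (0:ℝ),
        ∀ S : Finset (Site 2 × Fin 2), (∀ p ∈ S, medialPoint δ (medialVertexOf p) ∈ K) →
          ∑ p ∈ S, ‖onceKappa true * onceChiralObs (Λ δ) δ (1 / 3) (medialVertexOf p) true +
              onceKappa false * onceChiralObs (Λ δ) δ (1 / 3) (medialVertexOf p) false‖ ≤
            ε * δ ^ (-(5:ℝ) / 3)) :
    Summit.CriticalPhenomena.CardyFormulaZ2.Theses.CardySusyWard.WeakHolomorphy :=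
  weakHolomorphy_of_kirchhoffL1 (stub_kirchhoffL1OfChiralityLaw hlaw)

end Summit.CriticalPhenomena.CardyFormulaZ2.Theorems.WeakHolomorphy.SplitBypass

end
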